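import Literature.Analysis.FunctionSpaces.TorusCellAveragesProofs
import HarnessLib

/-!
# Vanishing cell averages force a small `Ḣ⁻¹` norm — discharge

Analysis/FunctionSpaces: discharge of the named fact
`Torus.eHomSobolevSeminorm_neg_one_le_of_cellAverage_eq_zero d` (`TorusCellAverages.lean`) for
every finite index type `d`, with the constant `C = 2π √(2^{|d|} |d|)`:
for `f ∈ L²(T^d; ℝ)` with zero averages on all grid cells of mesh `N⁻¹` (read on the lift),
`‖f‖_{Ḣ⁻¹(T^d)} ≤ (C/N) ‖f‖_{L²(T^d)}`. Proof: for a finite symmetric `S ⊆ ℤ^d ∖ {0}` let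
`g_S = Re Σ_{k∈S} |k|⁻² f̂(k) e_k`; then `X_S := Σ_{k∈S} |k|⁻²|f̂(k)|² = ∫ f g_S` and
`‖∇g_S‖²_{L²} = 4π² X_S` (`TorusCellAveragesProofs`), and the global estimate
`|∫ f g_S| ≤ (√(2ᵈd)/N)‖f‖_{L²}‖∇g_S‖_{L²}` gives `X_S ≤ (C/N)²‖f‖²_{L²}`; the `Ḣ⁻¹` sum
`Σ_{k≠0} |k|⁻²|f̂(k)|²` is the supremum of the `X_S` (enlarge any finite set of frequencies to a
symmetric one avoiding `0`). This is the estimate behind Bruè–De Lellis 2023, Thm. 4.1 (b), third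
line (`‖ρ_n(t)‖_{Ḣ⁻¹} ≤ C 5⁻ⁿ` from the patching (4.3) and (ii)); with it, the reduction
`Literature.Analysis.FluidPDE.alberti_crippa_mazzucato_family_of_planar` depends on the planar
family alone.

## References

* E. Bruè, C. De Lellis, Comm. Math. Phys. 400 (2023), Thm. 4.1 (b), (4.3), §4.1 (ii)
  (arXiv:2207.06301, p. 9).
-/

noncomputable section

open MeasureTheory Set Filter UnitAddTorus
open scoped ENNReal NNReal ComplexConjugate

namespace Literature.Analysis.FunctionSpaces

namespace Torus

variable (d : Type*) [Fintype d] [DecidableEq d]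

/-! ## The discharge -/

section Discharge

/-- **Discharge of `Torus.eHomSobolevSeminorm_neg_one_le_of_cellAverage_eq_zero`.** With
`C = 2π √(2ᵈ d)`: for `f ∈ L²(T^d; ℝ)` with zero averages on all cells of mesh `N⁻¹`,
`‖f‖_{Ḣ⁻¹} ≤ (C/N) ‖f‖_{L²}`. For a finite symmetric `S ⊆ ℤ^d ∖ {0}` and
`g_S = Re Σ_{k∈S} |k|⁻² f̂(k) e_k` one has `X_S := Σ_{k∈S} |k|⁻²|f̂(k)|² = ∫ f g_S`
(`integral_mul_reTrigPoly_weight`) and `‖∇g_S‖²_{L²} = 4π² X_S`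
(`integral_norm_sq_gradient_reTrigPoly_invWeight`), so the global estimate gives
`X_S ≤ (√(2ᵈd)/N) ‖f‖_{L²} · 2π √X_S`, i.e. `X_S ≤ (C/N)² ‖f‖²_{L²}`; the `Ḣ⁻¹` sum is the
supremum of the `X_S`. [folklore] -/
theorem eHomSobolevSeminorm_neg_one_le_of_cellAverage_eq_zero_holds :
    eHomSobolevSeminorm_neg_one_le_of_cellAverage_eq_zero d := by
  set K : ℝ := Real.sqrt (2 ^ Fintype.card d * Fintype.card d) with hK
  refine ⟨2 * Real.pi * K, fun N hN f hf hcell => ?_⟩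
  have hK0 : 0 ≤ K := Real.sqrt_nonneg _
  have hN' : (0 : ℝ) < N := by exact_mod_cast hN
  set Fc : UnitAddTorus d → ℂ := fun x => (f x : ℂ) with hFc
  set w : (d → ℤ) → ℝ := fun k => (freqNormSq k)⁻¹ with hw
  set B : ℝ≥0∞ := ENNReal.ofReal ((2 * Real.pi * K / N) ^ 2) * eLpNorm f 2 volume ^ (2 : ℝ) with hB
  -- Step 1: the bound for every finite symmetric `S ∌ 0`
  have hXS : ∀ S : Finset (d → ℤ), (∀ k ∈ S, -k ∈ S) → (0 : d → ℤ) ∉ S →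
      ENNReal.ofReal (∑ k ∈ S, w k * ‖mFourierCoeff Fc k‖ ^ 2) ≤ B := by
    intro S hS hS0
    set X : ℝ := ∑ k ∈ S, w k * ‖mFourierCoeff Fc k‖ ^ 2 with hX
    have hX0 : 0 ≤ X := Finset.sum_nonneg fun k _ =>
      mul_nonneg (inv_nonneg.2 (freqNormSq_nonneg k)) (sq_nonneg _)
    set g : UnitAddTorus d → ℝ := reTrigPoly S (fun k => ((w k : ℝ) : ℂ) • mFourierCoeff Fc k)
      with hg
    have hgs : IsSmooth g := isSmooth_reTrigPoly S _
    have hw' : ∀ k, w (-k) = w k := fun k => by simp [hw, freqNormSq_neg]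
    -- the pairing and the gradient
    have hpair : ∫ x, f x * g x = X := integral_mul_reTrigPoly_weight hf hS hw'
    have hgrad : ∫ x, ‖Torus.gradient g x‖ ^ 2 = 4 * Real.pi ^ 2 * X :=
      integral_norm_sq_gradient_reTrigPoly_invWeight hS hS0
    have hgradE : ∫⁻ x, ‖Torus.gradient g x‖ₑ ^ 2 = ENNReal.ofReal (4 * Real.pi ^ 2 * X) := by
      rw [← hgrad, ofReal_integral_eq_lintegral_ofReal]
      · refine lintegral_congr fun x => ?_
        rw [← ofReal_norm, ENNReal.ofReal_pow (norm_nonneg _)]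
      · exact ((hgs.gradient.continuous.norm).pow 2).integrable_unitAddTorus
      · exact ae_of_all _ fun x => sq_nonneg _
    -- the global estimate
    have hglob := enorm_integral_mul_le_of_cellAverage hN hf hgs hcell
    rw [hpair, hgradE, Real.enorm_eq_ofReal hX0] at hglob
    -- `(4π² X)^{1/2} = 2π √X`
    have hsq : (ENNReal.ofReal (4 * Real.pi ^ 2 * X)) ^ (1 / 2 : ℝ) =
        ENNReal.ofReal (2 * Real.pi) * ENNReal.ofReal (Real.sqrt X) := by
      rw [ENNReal.ofReal_rpow_of_nonneg (by positivity) (by norm_num), ← Real.sqrt_eq_rpow,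
        ← ENNReal.ofReal_mul (by positivity),
        show 4 * Real.pi ^ 2 * X = (2 * Real.pi) ^ 2 * X by ring,
        Real.sqrt_mul (by positivity), Real.sqrt_sq (by positivity)]
    rw [hsq] at hglob
    -- cancel `√X`
    have hXsq : ENNReal.ofReal X = ENNReal.ofReal (Real.sqrt X) * ENNReal.ofReal (Real.sqrt X) := by
      rw [← ENNReal.ofReal_mul (Real.sqrt_nonneg _), Real.mul_self_sqrt hX0]
    have hroot : ENNReal.ofReal (Real.sqrt X) ≤
        ENNReal.ofReal (K / N) * eLpNorm f 2 volume * ENNReal.ofReal (2 * Real.pi) := by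
      rcases eq_or_lt_of_le hX0 with hX00 | hXpos
      · simp [← hX00]
      · have hne : ENNReal.ofReal (Real.sqrt X) ≠ 0 := by
          rw [Ne, ENNReal.ofReal_eq_zero, not_le]; exact Real.sqrt_pos.2 hXpos
        have hfin : ENNReal.ofReal (Real.sqrt X) ≠ ∞ := ENNReal.ofReal_ne_top
        rw [hXsq, ← mul_assoc] at hglob
        exact (ENNReal.mul_le_mul_iff_left hne hfin).1 hglob
    calc ENNReal.ofReal X = ENNReal.ofReal (Real.sqrt X) ^ (2 : ℝ) := by
          rw [hXsq, ← sq, ← ENNReal.rpow_natCast]; norm_num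
      _ ≤ (ENNReal.ofReal (K / N) * eLpNorm f 2 volume * ENNReal.ofReal (2 * Real.pi)) ^ (2 : ℝ) := by
          gcongr
      _ = B := by
          rw [hB, ENNReal.mul_rpow_of_nonneg _ _ (by norm_num),
            ENNReal.mul_rpow_of_nonneg _ _ (by norm_num),
            ENNReal.ofReal_rpow_of_nonneg (by positivity) (by norm_num),
            ENNReal.ofReal_rpow_of_nonneg (by positivity) (by norm_num), mul_comm, ← mul_assoc,
            ← ENNReal.ofReal_mul (by positivity)]
          congr 2
          rw [Real.rpow_two, Real.rpow_two]
          ring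
  -- Step 2: the `Ḣ⁻¹` sum is dominated by `B`
  have hterm : ∀ k : d → ℤ, k ≠ 0 →
      (if k = 0 then 0 else ENNReal.ofReal (freqNormSq k ^ (-1 : ℝ))) * ‖mFourierCoeff Fc k‖ₑ ^ 2 =
        ENNReal.ofReal (w k * ‖mFourierCoeff Fc k‖ ^ 2) := by
    intro k hk
    rw [if_neg hk, Real.rpow_neg_one, ← ofReal_norm, ← ENNReal.ofReal_pow (norm_nonneg _),
      ← ENNReal.ofReal_mul (inv_nonneg.2 (freqNormSq_nonneg k))]
  have htsum : (∑' k : d → ℤ, (if k = 0 then 0 else ENNReal.ofReal (freqNormSq k ^ (-1 : ℝ))) *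
      ‖mFourierCoeff Fc k‖ₑ ^ 2) ≤ B := by
    rw [ENNReal.tsum_eq_iSup_sum]
    refine iSup_le fun T => ?_
    -- enlarge `T` to a symmetric set without `0`
    set S : Finset (d → ℤ) := (T ∪ T.image Neg.neg).erase 0 with hSdef
    have hS : ∀ k ∈ S, -k ∈ S := by
      intro k hk
      rw [hSdef, Finset.mem_erase, Finset.mem_union, Finset.mem_image] at hk ⊢
      refine ⟨neg_ne_zero.2 hk.1, ?_⟩
      rcases hk.2 with h | ⟨k', hk', rfl⟩
      · exact Or.inr ⟨k, h, rfl⟩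
      · exact Or.inl (by simpa using hk')
    have hS0 : (0 : d → ℤ) ∉ S := by simp [hSdef]
    have hsub : T ⊆ insert 0 S := by
      intro k hk
      by_cases hk0 : k = 0
      · simp [hk0]
      · exact Finset.mem_insert_of_mem (by simp [hSdef, hk0, hk])
    calc ∑ k ∈ T, (if k = 0 then 0 else ENNReal.ofReal (freqNormSq k ^ (-1 : ℝ))) *
          ‖mFourierCoeff Fc k‖ₑ ^ 2
        ≤ ∑ k ∈ insert 0 S, (if k = 0 then 0 else ENNReal.ofReal (freqNormSq k ^ (-1 : ℝ))) *
          ‖mFourierCoeff Fc k‖ₑ ^ 2 := Finset.sum_le_sum_of_subset hsub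
      _ = ∑ k ∈ S, ENNReal.ofReal (w k * ‖mFourierCoeff Fc k‖ ^ 2) := by
          rw [Finset.sum_insert hS0, if_pos rfl, zero_mul, zero_add]
          exact Finset.sum_congr rfl fun k hk => hterm k fun h => hS0 (h ▸ hk)
      _ = ENNReal.ofReal (∑ k ∈ S, w k * ‖mFourierCoeff Fc k‖ ^ 2) :=
          (ENNReal.ofReal_sum_of_nonneg fun k _ =>
            mul_nonneg (inv_nonneg.2 (freqNormSq_nonneg k)) (sq_nonneg _)).symm
      _ ≤ B := hXS S hS hS0
  -- Step 3: take square roots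
  calc eHomSobolevSeminorm (-1) Fc
      = (∑' k : d → ℤ, (if k = 0 then 0 else ENNReal.ofReal (freqNormSq k ^ (-1 : ℝ))) *
          ‖mFourierCoeff Fc k‖ₑ ^ 2) ^ (1 / 2 : ℝ) := rfl
    _ ≤ B ^ (1 / 2 : ℝ) := by gcongr
    _ = ENNReal.ofReal (2 * Real.pi * K / N) * eLpNorm f 2 volume := by
        rw [hB, ENNReal.mul_rpow_of_nonneg _ _ (by norm_num),
          ENNReal.ofReal_rpow_of_nonneg (sq_nonneg _) (by norm_num), ← ENNReal.rpow_mul,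
          ← Real.sqrt_eq_rpow, Real.sqrt_sq (by positivity)]
        norm_num

end Discharge

end Torus

end Literature.Analysis.FunctionSpaces

end
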